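import Literature.AlgebraicGeometry.HilbertScheme.HilbertSchemeTranslationAction
import Literature.AlgebraicGeometry.Motives.AbelianVarietyComplexPoints
import HarnessLib

/-!
# Translations of an abelian variety act trivially on `H*(A(ℂ); ℂ)` (proved)

Layer `Literature/AlgebraicGeometry/HilbertScheme`; theorems only, no definition, no named fact.  Rider on
`HilbertSchemeTranslationAction` (the translation `AbelianVariety.translate A a = (toUnit ≫ a) * 𝟙 : A ⟶ A` by a
point `a : 𝟙_ ⟶ A.X`, the deck transformations `(t_{b⁻¹} × τ_b)(ℂ)` of the Kummer cover `Θ : A × K → A^[n+1]`) and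
on `Motives.AbelianVarietyComplexPoints` (the tree's PROVED "translations act trivially on Betti cohomology" with
`ℚ`-coefficients, `AbelianVariety.bettiCohomology_map_const_mul`, for points `a ∈ A(ℂ) = (specOver ℂ ℂ ⟶ A.X)`).
This file supplies the statements in the form the lane-(V) transfer step consumes:

* `AbelianVariety.complexBetti_map_const_mul` — with COMPLEX coefficients, the left translate `a · f` of
  `f : X ⟶ A` induces the same map `Hⁱ(A(ℂ); ℂ) → Hⁱ(X(ℂ); ℂ)` as `f` (same proof as the tree's `ℚ`-version:
  translation by `a` is homotopic to the identity of the path-connected group `A(ℂ)`,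
  `ContinuousMap.homotopic_mulLeft_id`, and singular cohomology is homotopy invariant,
  `singularCohomology.map_eq_of_homotopic'`; the right-translate `ℂ`-version is already the tree's
  `HodgeTheory.complexBetti_map_mul_toSpecOver_comp`, not restated);
* `AbelianVariety.translate_eq_const_mul` — `t_a` for `a : 𝟙_ ⟶ A.X` is the left translate of `𝟙 A` by the point
  `toUnit (specOver ℂ ℂ) ≫ a ∈ A(ℂ)` (the two models `𝟙_` and `specOver ℂ ℂ` of the base);
* `AbelianVariety.complexBetti_map_translate` (**`t_a^* = 𝟙` on `Hⁱ(A(ℂ); ℂ)`**), `complexBetti_map_translate_apply`,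
  and the `ℚ`-version `bettiCohomology_map_translate`.

Source: Mumford, *Abelian Varieties* §1 (1)–(2) (the homotopy `t ↦ t_{γ(t)}` along a path shows that `A(ℂ)` acts
trivially on its cohomology); Hatcher §3.1 p. 201 (homotopy invariance).

## Part 2 (appended): the induced translations `t_a^{[n]}` of a Hilbert scheme act trivially on `H*(A^[n](ℂ); ℂ)`

For ANY morphism `act : A × H ⟶ H` and points `a, a' : 𝟙_ ⟶ A.X`, the maps `translateHilb act a = act(a, ·)` and
`translateHilb act a'` are homotopic on complex points — `(t, ξ) ↦ act(γ(t), ξ)` along a path `γ` from `a` to `a'` in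
the path-connected group `A(ℂ)`, continuous because `act(ℂ)` is continuous and `(A × H)(ℂ) ≃ₜ A(ℂ) × H(ℂ)`
(`AlgPoints.continuous_prodEquiv_symm`) — hence induce the same map on `Hᵏ(H(ℂ); ℂ)`
(`complexBetti_map_translateHilb_eq`); and for a TRANSLATION ACTION on a Hilbert scheme `(H, Ξ)`
(`IsTranslationAction Ξ act`), `translateHilb act 1 = 𝟙 H` (`IsTranslationAction.translateHilb_one`: the translate
of the universal family by the unit is the family itself, universal property), so
**`(t_a^{[n]})^* = 𝟙` on `Hᵏ(A^[n](ℂ); ℂ)` for every `a ∈ A(ℂ)`** (`IsTranslationAction.complexBetti_map_translateHilb`)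
— the input "`A` acts trivially on `H*(A^[n])`, being connected" of Beauville §7 / Kapfer–Menet §5 (used for
`τ_b^* ∘ θ^* = θ^*` on the Kummer fibre).  [cite: Beauville1983, §7 p. 769] [cite: KapferMenet2018, Lemma 5.4 p. 13]

## Part 3 (appended): the Kummer cover on the slices `{a} × K`

For a Kummer fibre `j : K ⟶ H` and the Kummer cover `Θ = kummerCover act j = act ∘ (A × j)` ("`u(a, ξ) = a + ξ`"):
`(a, 𝟙_K) ≫ Θ = j ≫ t_a^{[n]}` for every point `a` (`lift_const_id_comp_kummerCover`; the slice map is `ξ ↦ (a, ξ)`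
on complex points, `map_lift_const_id_apply`), hence for a translation action **`(1, 𝟙_K) ≫ Θ = j`**
(`IsTranslationAction.lift_one_id_comp_kummerCover`, with its continuous-map and `Hᵏ` forms
`mapContinuous_kummerCover_comp_sliceOne`, `complexBetti_map_kummerCover_comp_sliceOne`: `(1, 𝟙_K)^* ∘ Θ^* = θ^*`)
— the restriction step "`θ = Θ|_{0 × K}`" by which `im Θ^* = H*(A × K)^{A[n+1]}` (transfer) descends to
`im θ^* ⊇ H*(K)^{A[n+1]}`.  [cite: Beauville1983, §7 p. 769 footnote 2] [cite: KapferMenet2018, Lemma 5.4 (proof) p. 13]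
-/

noncomputable section

open CategoryTheory MonoidalCategory CartesianMonoidalCategory
open Literature.AlgebraicTopology.SingularHomology
open Literature.AlgebraicGeometry.Motives (SchemeOver AbelianVariety ComplexPoints AlgPoints specOver toSpecOver)
open Literature.AlgebraicGeometry.HodgeTheory (complexBetti)
open scoped MonObj

namespace Literature.AlgebraicGeometry.HilbertScheme

variable {A : AbelianVariety ℂ} {X : SchemeOver ℂ}

/-- **Translations act trivially on `Hⁱ(A(ℂ); ℂ)`** (left translates): for `f : X ⟶ A` and `a ∈ A(ℂ)`, the left
translate `a · f` induces the same map `Hⁱ(A(ℂ); ℂ) → Hⁱ(X(ℂ); ℂ)` as `f`. [cite: HatcherAT2002, §3.1 p. 201]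
[cite: MumfordAV1970, §1 (1)–(2)] -/
theorem _root_.Literature.AlgebraicGeometry.Motives.AbelianVariety.complexBetti_map_const_mul (f : X ⟶ A.X)
    (a : A.Points ℂ) (i : ℕ) :
    complexBetti.map ((toSpecOver X ≫ a) * f) i = complexBetti.map f i := by
  change singularCohomology.map ℂ ℂ (AlgPoints.mapContinuous (L := ℂ) ((toSpecOver X ≫ a) * f)) i = _
  rw [AbelianVariety.mapContinuous_const_mul, singularCohomology.map_comp,
    singularCohomology.map_eq_of_homotopic' ℂ ℂ (ContinuousMap.homotopic_mulLeft_id a) i,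
    singularCohomology.map_id, Category.id_comp]

/-- The translation `t_a` by a point `a : 𝟙_ ⟶ A.X` is the left translate of `𝟙 A` by the point
`toUnit (Spec ℂ) ≫ a ∈ A(ℂ)` (the two terminal objects `𝟙_` and `specOver ℂ ℂ` of `SchemeOver ℂ`).
[cite: Beauville1983, §7 p. 769] -/
theorem _root_.Literature.AlgebraicGeometry.Motives.AbelianVariety.translate_eq_const_mul
    (a : 𝟙_ (SchemeOver ℂ) ⟶ A.X) :
    A.translate a = (toSpecOver A.X ≫ (toUnit (specOver ℂ ℂ) ≫ a)) * 𝟙 A.X := by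
  rw [AbelianVariety.translate_def, ← Category.assoc, toUnit_unique (toSpecOver A.X ≫ toUnit (specOver ℂ ℂ))
    (toUnit A.X)]
  rfl

/-- **`t_a^* = 𝟙` on `Hⁱ(A(ℂ); ℂ)`**: a translation of a complex abelian variety acts as the identity on its complex
cohomology. [cite: MumfordAV1970, §1 (1)–(2)] [cite: HatcherAT2002, §3.1 p. 201] -/
theorem _root_.Literature.AlgebraicGeometry.Motives.AbelianVariety.complexBetti_map_translate
    (a : 𝟙_ (SchemeOver ℂ) ⟶ A.X) (i : ℕ) : complexBetti.map (A.translate a) i = 𝟙 _ := by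
  rw [AbelianVariety.translate_eq_const_mul, AbelianVariety.complexBetti_map_const_mul, HodgeTheory.complexBetti.map_id]

/-- `t_a^* x = x` for every `x ∈ Hⁱ(A(ℂ); ℂ)`. [cite: MumfordAV1970, §1 (1)–(2)] -/
theorem _root_.Literature.AlgebraicGeometry.Motives.AbelianVariety.complexBetti_map_translate_apply
    (a : 𝟙_ (SchemeOver ℂ) ⟶ A.X) (i : ℕ) (x : complexBetti A.X i) : complexBetti.map (A.translate a) i x = x := by
  rw [AbelianVariety.complexBetti_map_translate]
  rfl

/-- **`t_a^* = 𝟙` on `Hⁱ(A(ℂ); ℚ)`** (rational coefficients). [cite: MumfordAV1970, §1 (1)–(2)]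
[cite: HatcherAT2002, §3.1 p. 201] -/
theorem _root_.Literature.AlgebraicGeometry.Motives.AbelianVariety.bettiCohomology_map_translate
    (a : 𝟙_ (SchemeOver ℂ) ⟶ A.X) (i : ℕ) : Motives.bettiCohomology.map (A.translate a) i = 𝟙 _ := by
  rw [AbelianVariety.translate_eq_const_mul, AbelianVariety.bettiCohomology_map_const_mul, Motives.bettiCohomology.map_id]

/-! ### Part 2: the translations `t_a^{[n]}` of a Hilbert scheme act trivially on cohomology -/

section HilbertTranslation

variable {H : SchemeOver ℂ}

/-- On complex points, `t_a^{[n]}(ξ) = act(a, ξ)`: the value of `translateHilb act a` at `ξ ∈ H(ℂ)` is `act(ℂ)`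
at the pair `(a, ξ) ∈ A(ℂ) × H(ℂ) = (A × H)(ℂ)`. [cite: KapferMenet2018, Lemma 5.4 (proof) p. 13] -/
theorem mapContinuous_translateHilb_apply (act : A.X ⊗ H ⟶ H) (a : 𝟙_ (SchemeOver ℂ) ⟶ A.X)
    (ξ : ComplexPoints H) :
    AlgPoints.mapContinuous (L := ℂ) (translateHilb act a) ξ =
      AlgPoints.map act ((AlgPoints.prodEquiv (X := A.X) (Y := H) (L := ℂ)).symm
        (toUnit (specOver ℂ ℂ) ≫ a, ξ)) := by
  rw [AlgPoints.mapContinuous_apply, AlgPoints.map_apply, AlgPoints.map_apply, AlgPoints.prodEquiv_symm_apply,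
    translateHilb, ← Category.assoc]
  congr 1
  refine CartesianMonoidalCategory.hom_ext _ _ ?_ ?_
  · rw [Category.assoc, lift_fst, lift_fst, ← Category.assoc, toUnit_unique (ξ ≫ toUnit H) (toUnit _)]
  · rw [Category.assoc, lift_snd, lift_snd, Category.comp_id]

/-- **`t_a^{[n]}` and `t_{a'}^{[n]}` are homotopic on complex points** for any two points `a, a'` of `A` (along a
path from `a` to `a'` in the path-connected group `A(ℂ)`; `act(ℂ)` is jointly continuous).
[cite: MumfordAV1970, §1 (1)–(2)] [cite: Beauville1983, §7 p. 769] -/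
theorem homotopic_mapContinuous_translateHilb (act : A.X ⊗ H ⟶ H) (a a' : 𝟙_ (SchemeOver ℂ) ⟶ A.X) :
    (AlgPoints.mapContinuous (L := ℂ) (translateHilb act a)).Homotopic
      (AlgPoints.mapContinuous (L := ℂ) (translateHilb act a')) := by
  let p : Path (toUnit (specOver ℂ ℂ) ≫ a : A.Points ℂ) (toUnit (specOver ℂ ℂ) ≫ a') :=
    PathConnectedSpace.somePath _ _
  have hΦ : Continuous fun z : A.Points ℂ × ComplexPoints H ↦
      AlgPoints.map act ((AlgPoints.prodEquiv (X := A.X) (Y := H) (L := ℂ)).symm z) :=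
    (AlgPoints.continuous_map act).comp AlgPoints.continuous_prodEquiv_symm
  exact ⟨{ toFun := fun tξ ↦ AlgPoints.map act ((AlgPoints.prodEquiv (X := A.X) (Y := H) (L := ℂ)).symm (p tξ.1, tξ.2))
           continuous_toFun := hΦ.comp ((p.continuous.comp continuous_fst).prodMk continuous_snd)
           map_zero_left := fun ξ ↦ by rw [p.source, mapContinuous_translateHilb_apply]
           map_one_left := fun ξ ↦ by rw [p.target, mapContinuous_translateHilb_apply] }⟩

/-- **All translations `t_a^{[n]}` induce the same map on `Hᵏ(H(ℂ); ℂ)`** (homotopy invariance of singular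
cohomology). [cite: HatcherAT2002, §3.1 p. 201] [cite: Beauville1983, §7 p. 769] -/
theorem complexBetti_map_translateHilb_eq (act : A.X ⊗ H ⟶ H) (a a' : 𝟙_ (SchemeOver ℂ) ⟶ A.X) (k : ℕ) :
    complexBetti.map (translateHilb act a) k = complexBetti.map (translateHilb act a') k :=
  singularCohomology.map_eq_of_homotopic' ℂ ℂ (homotopic_mapContinuous_translateHilb act a a') k

/-- The translate of the universal family by the unit is the universal family: the composite
`A × H → A × (A × H) → A × (A × H) → A × H`, `(x, ξ) ↦ (x, (1, ξ)) ↦ (1⁻¹ x, (1, ξ)) ↦ (1⁻¹x, ξ)`, is the identity.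
[cite: Beauville1983, §7 p. 769] -/
theorem whiskerLeft_lift_one_comp_translateShear_comp_whiskerLeft_snd :
    (A.X ◁ lift (toUnit H ≫ (1 : 𝟙_ (SchemeOver ℂ) ⟶ A.X)) (𝟙 H)) ≫ translateShear A H ≫ (A.X ◁ snd A.X H) =
      𝟙 (A.X ⊗ H) := by
  refine CartesianMonoidalCategory.hom_ext _ _ ?_ ?_
  · rw [Category.assoc, Category.assoc, whiskerLeft_fst, translateShear, lift_fst, MonObj.comp_mul, GrpObj.comp_inv,
      whiskerLeft_fst, ← Category.assoc, whiskerLeft_snd, Category.assoc, lift_fst, MonObj.comp_one,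
      MonObj.comp_one, inv_one, one_mul, Category.id_comp]
  · rw [Category.assoc, Category.assoc, whiskerLeft_snd, ← Category.assoc (translateShear A H), translateShear_snd,
      ← Category.assoc, whiskerLeft_snd, Category.assoc, lift_snd, Category.comp_id, Category.id_comp]

/-- **`t_1^{[n]} = 𝟙`**: a translation action of `A` on a Hilbert scheme `(H, Ξ)` of points of `A` is unital — the
translate by the unit classifies the universal family itself (universal property, `hom_ext`).
[cite: Beauville1983, §7 p. 769] [cite: StacksProject, Tag 0B94] -/
theorem IsTranslationAction.translateHilb_one {n : ℕ} {Ξ : (A.X ⊗ H).left.IdealSheafData}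
    (hH : IsHilbertSchemeOfPoints n A.X H Ξ) {act : A.X ⊗ H ⟶ H} (h : IsTranslationAction Ξ act) :
    translateHilb act 1 = 𝟙 H := by
  apply hH.hom_ext
  rw [translateHilb, IsHilbertSchemeOfPoints.comap_whiskerLeft_comp, h, translatedFamily,
    ← AlgebraicGeometry.Scheme.IdealSheafData.comap_comp, ← AlgebraicGeometry.Scheme.IdealSheafData.comap_comp,
    ← Over.comp_left, ← Over.comp_left, Category.assoc,
    whiskerLeft_lift_one_comp_translateShear_comp_whiskerLeft_snd, MonoidalCategory.whiskerLeft_id]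

/-- **The translations of `A` act trivially on `Hᵏ(A^[n](ℂ); ℂ)`**: for a translation action `act` on a Hilbert
scheme `(H, Ξ)` of points of the abelian variety `A` and every point `a`, `(t_a^{[n]})^* = 𝟙` ("`A` étant connexe,
`A` opère trivialement sur la cohomologie" — homotopy along a path to the unit, then `t_1^{[n]} = 𝟙`).
[cite: Beauville1983, §7 p. 769] [cite: KapferMenet2018, Lemma 5.4 p. 13] [cite: HatcherAT2002, §3.1 p. 201] -/
theorem IsTranslationAction.complexBetti_map_translateHilb {n : ℕ} {Ξ : (A.X ⊗ H).left.IdealSheafData}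
    (hH : IsHilbertSchemeOfPoints n A.X H Ξ) {act : A.X ⊗ H ⟶ H} (h : IsTranslationAction Ξ act)
    (a : 𝟙_ (SchemeOver ℂ) ⟶ A.X) (k : ℕ) : complexBetti.map (translateHilb act a) k = 𝟙 _ := by
  rw [complexBetti_map_translateHilb_eq act a 1 k, h.translateHilb_one hH, HodgeTheory.complexBetti.map_id]

/-- `(t_a^{[n]})^* x = x`. [cite: Beauville1983, §7 p. 769] -/
theorem IsTranslationAction.complexBetti_map_translateHilb_apply {n : ℕ} {Ξ : (A.X ⊗ H).left.IdealSheafData}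
    (hH : IsHilbertSchemeOfPoints n A.X H Ξ) {act : A.X ⊗ H ⟶ H} (h : IsTranslationAction Ξ act)
    (a : 𝟙_ (SchemeOver ℂ) ⟶ A.X) (k : ℕ) (x : complexBetti H k) : complexBetti.map (translateHilb act a) k x = x := by
  rw [h.complexBetti_map_translateHilb hH a k]
  rfl

end HilbertTranslation

/-! ### Part 3: the Kummer cover on the slices `{a} × K` -/

section KummerCoverSlice

variable {H K : SchemeOver ℂ}

/-- **`Θ(a, ξ) = t_a^{[n]}(j ξ)`**: on the slice `{a} × K` the Kummer cover `Θ = act ∘ (A × j)` of a Kummer fibre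
`j : K ⟶ H` is `t_a^{[n]} ∘ j`, i.e. `(a, 𝟙_K) ≫ Θ = j ≫ t_a^{[n]}` ("`u(a, ξ) = a + ξ`").
[cite: Beauville1983, §7 p. 769 footnote 2] [cite: KapferMenet2018, Lemma 5.4 (proof) p. 13] -/
theorem lift_const_id_comp_kummerCover (act : A.X ⊗ H ⟶ H) (j : K ⟶ H) (a : 𝟙_ (SchemeOver ℂ) ⟶ A.X) :
    lift (toUnit K ≫ a) (𝟙 K) ≫ kummerCover act j = j ≫ translateHilb act a := by
  rw [kummerCover, translateHilb, lift_whiskerLeft_assoc, Category.id_comp, comp_lift_assoc, Category.comp_id,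
    comp_toUnit_assoc]

/-- On complex points the slice map `(a, 𝟙_K) : K → A × K` is `ξ ↦ (a, ξ)` (the slice `{a} × K_r` of Beauville's
`u : A × K_r → A^[r+1]`). [cite: Beauville1983, §7 p. 769 footnote 2] [cite: KapferMenet2018, Lemma 5.4 (proof) p. 13] -/
theorem map_lift_const_id_apply (a : 𝟙_ (SchemeOver ℂ) ⟶ A.X) (ξ : ComplexPoints K) :
    AlgPoints.map (lift (toUnit K ≫ a) (𝟙 K)) ξ =
      (AlgPoints.prodEquiv (X := A.X) (Y := K) (L := ℂ)).symm (toUnit (specOver ℂ ℂ) ≫ a, ξ) := by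
  rw [AlgPoints.map_apply, AlgPoints.prodEquiv_symm_apply, comp_lift, Category.comp_id, comp_toUnit_assoc]

/-- **`Θ(1, ξ) = j(ξ)`**: on the slice `{1} × K` the Kummer cover IS the fibre inclusion, `(1, 𝟙_K) ≫ Θ = j`, for a
translation action on a Hilbert scheme of points (`t_1^{[n]} = 𝟙`, `IsTranslationAction.translateHilb_one`).  This is
the restriction step "`θ = Θ|_{0 × K}`" of the transfer argument `im θ^* ⊇ H*(K)^{A[n+1]}`.
[cite: Beauville1983, §7 p. 769 footnote 2] [cite: KapferMenet2018, Lemma 5.4 (proof) p. 13] -/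
theorem IsTranslationAction.lift_one_id_comp_kummerCover {n : ℕ} {Ξ : (A.X ⊗ H).left.IdealSheafData}
    (hH : IsHilbertSchemeOfPoints n A.X H Ξ) {act : A.X ⊗ H ⟶ H} (h : IsTranslationAction Ξ act) (j : K ⟶ H) :
    lift (toUnit K ≫ (1 : 𝟙_ (SchemeOver ℂ) ⟶ A.X)) (𝟙 K) ≫ kummerCover act j = j := by
  rw [lift_const_id_comp_kummerCover, h.translateHilb_one hH, Category.comp_id]

/-- Complex-points form: `Θ(ℂ) ∘ (1, 𝟙_K)(ℂ) = j(ℂ)` as continuous maps `K(ℂ) → H(ℂ)`.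
[cite: Beauville1983, §7 p. 769 footnote 2] -/
theorem IsTranslationAction.mapContinuous_kummerCover_comp_sliceOne {n : ℕ} {Ξ : (A.X ⊗ H).left.IdealSheafData}
    (hH : IsHilbertSchemeOfPoints n A.X H Ξ) {act : A.X ⊗ H ⟶ H} (h : IsTranslationAction Ξ act) (j : K ⟶ H) :
    (AlgPoints.mapContinuous (L := ℂ) (kummerCover act j)).comp
        (AlgPoints.mapContinuous (L := ℂ) (lift (toUnit K ≫ (1 : 𝟙_ (SchemeOver ℂ) ⟶ A.X)) (𝟙 K))) =
      AlgPoints.mapContinuous (L := ℂ) j := by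
  rw [← AlgPoints.mapContinuous_comp, h.lift_one_id_comp_kummerCover hH j]

/-- Cohomological form: `(1, 𝟙_K)^* ∘ Θ^* = θ^*` on `Hᵏ( · (ℂ); ℂ)`, every `k`.
[cite: Beauville1983, §7 p. 769 footnote 2] -/
theorem IsTranslationAction.complexBetti_map_kummerCover_comp_sliceOne {n : ℕ}
    {Ξ : (A.X ⊗ H).left.IdealSheafData} (hH : IsHilbertSchemeOfPoints n A.X H Ξ) {act : A.X ⊗ H ⟶ H}
    (h : IsTranslationAction Ξ act) (j : K ⟶ H) (k : ℕ) :
    complexBetti.map (kummerCover act j) k ≫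
        complexBetti.map (lift (toUnit K ≫ (1 : 𝟙_ (SchemeOver ℂ) ⟶ A.X)) (𝟙 K)) k =
      complexBetti.map j k := by
  rw [← HodgeTheory.complexBetti.map_comp, h.lift_one_id_comp_kummerCover hH j]

end KummerCoverSlice

end Literature.AlgebraicGeometry.HilbertScheme

end
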